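import Summits.BirchSwinnertonDyer.BirchSwinnertonDyer.Theses.MordellShaFreeCut
import Literature.NumberTheory.EllipticCurves.HeegnerFieldDescentProofs

/-! # Route `MordellShaFreeCut` (rung S2b) — crux `RankPosOfThreeSelmerCorankOne`
(stmt-BirchSwinnertonDyer-19159), line `heegner-field-descent`: the registered stub
`stub_descentField` from refereed named facts

The BC3 skeleton of the crux (plan g8, sha16 9d8b91ca) composes
`stub_descentField → stub_shaFreeOverK → RankPosOfThreeSelmerCorankOne`. Its first stub — for `D ≠ 0`
with `corank_{ℤ₃} Sel_{3^∞}(E_D/ℚ) = 1` there is an imaginary quadratic `K` with the Heegner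
hypothesis for the full conductor of the Mordell curve `E_D : y² = x³ + D` and `3` split in `K`,
over which `E_D` keeps Selmer corank one and gains no rank — is fact-free as registered, but every printed input is
a REFEREED named fact of the tree: the `3`-parity theorem (`p_parity`, Dokchitser–Dokchitser 2010
Thm. 1.4), the Modularity Theorem (`ModularForms.exists_isNewformOf`), Hoffstein–Luo
1997 (`HoffsteinLuo1997_exists_twist_L_one_ne_zero`) and Kato 2004 Cor. 14.3
(`kato_finite_of_L_one_ne_zero`). This file lands the BINDER-CARRYING form
`facts → <stub statement verbatim>` (the day-1 currency of GAP-LEDGER-read2-skeletons-g25, sk-3),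
by specialising the tree theorem `exists_heegnerField_descent_of_selmerCorank_eq_one`
(`Literature/…/HeegnerFieldDescentProofs.lean`) to `W = mordellCurve D`, `p = 3`.
It supports, and does not close, the item: the load-bearing stub `stub_shaFreeOverK` (a 3-adic
anticyclotomic main conjecture with control for `E_D/K` + `p`-adic Waldspurger; Kříž 2020 §§9–10 /
Fan–Wan v2 Thm. 1.1–1.2, unrefereed) is untouched. -/

namespace Summit.BirchSwinnertonDyer.BirchSwinnertonDyer.Theorems.MordellShaFreeCutDescentField

open Literature.NumberTheory.EllipticCurves WeierstrassCurve

/-- **`stub_descentField` of crux `RankPosOfThreeSelmerCorankOne` from refereed facts** (statement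
after the binders = the registered stub, token for token): for `D ≠ 0` with
`corank_{ℤ₃} Sel_{3^∞}(E_D/ℚ) = 1` there is an imaginary quadratic field `K` satisfying the Heegner
hypothesis for `N(E_D)` and for `3`, with `corank_{ℤ₃} Sel_{3^∞}(E_D/K) = 1` and
`rank E_D(K) = rank E_D(ℚ)` — granted `3`-parity (`hpar`), modularity (`hmod`), Hoffstein–Luo
(`hHL`) and Kato (`hKato`). -/
theorem descentField_of_parity_of_hoffsteinLuo_of_kato
    (hpar : ∀ (W : WeierstrassCurve ℚ) [W.IsElliptic] (p : ℕ) [Fact p.Prime], p_parity W p)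
    (hmod : ModularForms.exists_isNewformOf) (hHL : HoffsteinLuo1997_exists_twist_L_one_ne_zero)
    (hKato : ∀ (W : WeierstrassCurve ℚ) [W.IsElliptic] (p : ℕ) [Fact p.Prime],
      kato_finite_of_L_one_ne_zero W p) :
    ∀ ⦃D : ℚ⦄, D ≠ 0 → (mordellCurve D).selmerCorank 3 = 1 →
      ∃ (K : Type) (_ : Field K) (_ : NumberField K),
        IsImaginaryQuadratic K ∧
          SatisfiesHeegnerHypothesis ((mordellCurve D).conductorNorm ℤ) K ∧
            SatisfiesHeegnerHypothesis 3 K ∧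
              ((mordellCurve D).baseChange K).selmerCorank 3 = 1 ∧
                ((mordellCurve D).baseChange K).mordellWeilRank =
                  (mordellCurve D).mordellWeilRank := by
  intro D hD hcorank
  haveI := isElliptic_mordellCurve hD
  obtain ⟨K, _, _, hK, -, hHN, hH3, -, -, hcK, hrk, -⟩ :=
    exists_heegnerField_descent_of_selmerCorank_eq_one hpar hmod hHL hKato (mordellCurve D) 3
      hcorank 0
  exact ⟨K, inferInstance, inferInstance, hK, hHN, hH3, hcK, hrk⟩

/-- **The same field also preserves the analytic rank and has `d_K ≡ 1 (mod 8)` with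
`L(E_D^{(d_K)}, 1) ≠ 0`** — the extra conjuncts a `K`-level argument for `stub_shaFreeOverK` may
consume (Artin factorisation `ord L(E_D/K) = ord L(E_D) + ord L(E_D^{(d_K)})`, the twist term `0`),
from the same four refereed facts. -/
theorem descentField_full_of_parity_of_hoffsteinLuo_of_kato
    (hpar : ∀ (W : WeierstrassCurve ℚ) [W.IsElliptic] (p : ℕ) [Fact p.Prime], p_parity W p)
    (hmod : ModularForms.exists_isNewformOf) (hHL : HoffsteinLuo1997_exists_twist_L_one_ne_zero)
    (hKato : ∀ (W : WeierstrassCurve ℚ) [W.IsElliptic] (p : ℕ) [Fact p.Prime],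
      kato_finite_of_L_one_ne_zero W p)
    {D : ℚ} (hD : D ≠ 0) (hcorank : (mordellCurve D).selmerCorank 3 = 1) (B : ℕ) :
    ∃ (K : Type) (_ : Field K) (_ : NumberField K),
      IsImaginaryQuadratic K ∧ B < (NumberField.discr K).natAbs ∧
        SatisfiesHeegnerHypothesis ((mordellCurve D).conductorNorm ℤ) K ∧
          SatisfiesHeegnerHypothesis 3 K ∧ NumberField.discr K % 8 = 1 ∧
            ((mordellCurve D).quadraticTwist (NumberField.discr K : ℚ)).entireLFunction 1 ≠ 0 ∧
              ((mordellCurve D).baseChange K).selmerCorank 3 = 1 ∧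
                ((mordellCurve D).baseChange K).mordellWeilRank = (mordellCurve D).mordellWeilRank ∧
                  analyticRankEK (mordellCurve D) K = (mordellCurve D).analyticRank := by
  haveI := isElliptic_mordellCurve hD
  exact exists_heegnerField_descent_of_selmerCorank_eq_one hpar hmod hHL hKato (mordellCurve D) 3
    hcorank B

end Summit.BirchSwinnertonDyer.BirchSwinnertonDyer.Theorems.MordellShaFreeCutDescentField
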